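import Mathlib.NumberTheory.ZetaValues
import Mathlib.Analysis.PSeries
import Summits.AnomalousDissipation.AnomalousDissipation.Theorems.SawtoothPulseCascadeK1LocalisedCascadeSlotPullback

/-!
# K1loc, line `Spectral` / SeqCone — helper: THE REMAINDER WEIGHT `Σ_q |q_j|^r |𝓕Θ(q)|` OF THE EXPANSION (B3b)

Helper file of the prover lane on the crux `K1LocalisedCascade` (stmt-AnomalousDissipation-19491), route
`SawtoothPulseCascade` (NOTES HANDOFF B3b).  The order-`r` remainder of `…SlotExpansion` is weighted by
`W_r = Σ_q |q_j|^r ‖𝓕Θ(q)‖` for a multiplier `Θ` read off `x_j`.  With the derivative multipliers `Θ_α`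
(`𝓕Θ_α(q) = (2πi q_j)^α 𝓕Θ(q)`) this is `(2π)^{-r} Σ_q ‖𝓕Θ_r(q)‖`, and two more derivatives make it summable with
`W_r ≤ B_{r+2} / (12 (2π)^r)` for any bound `B_{r+2}` of the coefficients of `Θ_{r+2}` (e.g. its sup norm), using
`Σ_{m ∈ ℤ∖0} m^{-2} = π²/3`.  Results: `hasSum_one_div_int_sq` and `tsum_pow_mul_norm_mFourierCoeff_le`.
No definitions; no statement about the stub.
[cite: Grafakos2014, Prop. 3.1.2 (5); Apostol1976, Thm. 12.17 (ζ(2) = π²/6)] [problem: turb]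
-/

-- `Summit.<Summit>.<Problem>`: single-conjunct summit, the duplicate namespace segment is deliberate.
set_option linter.dupNamespace false

noncomputable section

namespace Summit.AnomalousDissipation.AnomalousDissipation.Theorems.SawtoothPulseCascade.K1Slot

open MeasureTheory Set Filter Topology UnitAddTorus Complex
open Literature.Analysis Literature.Analysis.FunctionSpaces Literature.Analysis.FunctionSpaces.Torus

/-- `Σ_{m ∈ ℤ} 1/m² = π²/3` (with the convention `1/0 = 0`). [cite: Apostol1976, Thm. 12.17] -/
theorem hasSum_one_div_int_sq : HasSum (fun m : ℤ => (1 : ℝ) / (m : ℝ) ^ 2) (Real.pi ^ 2 / 3) := by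
  have h1 : HasSum (fun n : ℕ => (1 : ℝ) / ((n : ℤ) : ℝ) ^ 2) (Real.pi ^ 2 / 6) := by
    simpa using hasSum_zeta_two
  have h2 : HasSum (fun n : ℕ => (1 : ℝ) / ((-((n : ℤ) + 1) : ℤ) : ℝ) ^ 2) (Real.pi ^ 2 / 6) := by
    have h := (hasSum_nat_add_iff' 1).mpr hasSum_zeta_two
    simp only [Finset.range_one, Finset.sum_singleton, Nat.cast_zero, ne_eq, OfNat.ofNat_ne_zero,
      not_false_eq_true, zero_pow, div_zero, sub_zero] at h
    refine h.congr_fun fun n => ?_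
    push_cast
    ring
  have h := HasSum.of_nat_of_neg_add_one (f := fun m : ℤ => (1 : ℝ) / (m : ℝ) ^ 2) h1 h2
  convert h using 1
  ring

variable {d : Type*} [Fintype d] [DecidableEq d]

/-- **The remainder weight of the expansion.**  Let `Θ_α : T^d → ℂ` (`α ∈ ℕ`) satisfy the coefficient relation
`𝓕Θ_α(q) = (2πi q_j)^α 𝓕Θ_0(q)`, with `𝓕Θ_0` supported on the `e_j`-axis (a multiplier read off `x_j`) and
`‖𝓕Θ_{r+2}(q)‖ ≤ B` for all `q` (`r ≥ 1`).  Then `q ↦ |q_j|^r ‖𝓕Θ_0(q)‖` is summable and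
`Σ_q |q_j|^r ‖𝓕Θ_0(q)‖ ≤ B / (12 (2π)^r)`. [cite: Grafakos2014, Prop. 3.1.2 (5)] -/
theorem tsum_pow_mul_norm_mFourierCoeff_le {Θ : ℕ → UnitAddTorus d → ℂ} (j : d) {r : ℕ} (hr : 1 ≤ r)
    (hrel : ∀ α q, mFourierCoeff (Θ α) q = (2 * Real.pi * I * (q j : ℂ)) ^ α * mFourierCoeff (Θ 0) q)
    (haxis : ∀ (q : d → ℤ) (l : d), l ≠ j → q l ≠ 0 → mFourierCoeff (Θ 0) q = 0) {B : ℝ}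
    (hB : ∀ q, ‖mFourierCoeff (Θ (r + 2)) q‖ ≤ B) :
    (Summable fun q : d → ℤ => (|(q j : ℝ)|) ^ r * ‖mFourierCoeff (Θ 0) q‖) ∧
    ∑' q : d → ℤ, (|(q j : ℝ)|) ^ r * ‖mFourierCoeff (Θ 0) q‖ ≤ B / (12 * (2 * Real.pi) ^ r) := by
  have hB0 : 0 ≤ B := (norm_nonneg _).trans (hB 0)
  have h2π : 0 < 2 * Real.pi := by positivity
  -- the majorant `g`, supported on the axis
  set c : ℝ := B / (2 * Real.pi) ^ (r + 2) with hc
  have hc0 : 0 ≤ c := div_nonneg hB0 (pow_nonneg h2π.le _)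
  set g : (d → ℤ) → ℝ := fun q => if (∀ l, l ≠ j → q l = 0) then c * (1 / ((q j : ℝ)) ^ 2) else 0 with hg
  -- pointwise bound
  have hpt : ∀ q : d → ℤ, (|(q j : ℝ)|) ^ r * ‖mFourierCoeff (Θ 0) q‖ ≤ g q := by
    intro q
    by_cases hq : ∀ l, l ≠ j → q l = 0
    · rw [hg]
      simp only
      rw [if_pos hq]
      by_cases hqj : q j = 0
      · -- then `q = 0` and the weight `|q_j|^r` vanishes (`r ≥ 1`)
        rw [hqj, Int.cast_zero, abs_zero, zero_pow (by omega), zero_mul]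
        simp
      · have hrel' := hrel (r + 2) q
        have hne : (2 * Real.pi * I * (q j : ℂ)) ^ (r + 2) ≠ 0 := by
          apply pow_ne_zero
          simp [Real.pi_ne_zero, Complex.I_ne_zero, hqj]
        have heq : mFourierCoeff (Θ 0) q = mFourierCoeff (Θ (r + 2)) q / (2 * Real.pi * I * (q j : ℂ)) ^ (r + 2) := by
          rw [hrel', mul_div_cancel_left₀ _ hne]
        rw [heq, norm_div, norm_pow]
        have hn : ‖(2 * Real.pi * I * (q j : ℂ))‖ = 2 * Real.pi * |(q j : ℝ)| := by
          rw [norm_mul, norm_mul, norm_mul, Complex.norm_I, mul_one, Complex.norm_intCast, Complex.norm_real,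
            Complex.norm_ofNat, Real.norm_eq_abs, abs_of_pos Real.pi_pos]
        rw [hn]
        have hqpos : 0 < |(q j : ℝ)| := abs_pos.mpr (by exact_mod_cast hqj)
        have hsq : ((q j : ℝ)) ^ 2 = |(q j : ℝ)| ^ 2 := (sq_abs _).symm
        rw [hsq, hc, mul_pow, div_eq_mul_inv, div_eq_mul_inv, one_div]
        have key : (|(q j : ℝ)|) ^ r * (‖mFourierCoeff (Θ (r + 2)) q‖ * ((2 * Real.pi) ^ (r + 2) * |(q j : ℝ)| ^ (r + 2))⁻¹)
            = ‖mFourierCoeff (Θ (r + 2)) q‖ * ((2 * Real.pi) ^ (r + 2))⁻¹ * (|(q j : ℝ)| ^ 2)⁻¹ := by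
          field_simp
          ring
        rw [key]
        exact mul_le_mul_of_nonneg_right (mul_le_mul_of_nonneg_right (hB q) (inv_nonneg.mpr (pow_nonneg h2π.le _)))
          (inv_nonneg.mpr (sq_nonneg _))
    · -- off the axis the coefficient vanishes
      push Not at hq
      obtain ⟨l, hl, hql⟩ := hq
      rw [haxis q l hl hql, norm_zero, mul_zero, hg]
      simp only
      split_ifs <;> first | exact le_rfl | exact mul_nonneg hc0 (by positivity)
  -- the majorant is summable with sum `c π²/3`
  have hinj : Function.Injective (fun m : ℤ => (Pi.single j m : d → ℤ)) := fun a b h => by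
    simpa using congrFun h j
  have hsupp : Function.support g ⊆ Set.range (fun m : ℤ => (Pi.single j m : d → ℤ)) := by
    intro q hq
    rw [Function.mem_support, hg] at hq
    simp only [ne_eq, ite_eq_right_iff, Classical.not_imp] at hq
    refine ⟨q j, ?_⟩
    funext l
    by_cases hl : l = j
    · subst hl; simp
    · show (Pi.single j (q j) : d → ℤ) l = q l
      rw [Pi.single_eq_of_ne (M := fun _ : d => ℤ) hl, hq.1 l hl]
  have hcomp : (g ∘ fun m : ℤ => (Pi.single j m : d → ℤ)) = fun m : ℤ => c * (1 / (m : ℝ) ^ 2) := by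
    funext m
    simp only [Function.comp_apply, hg, Pi.single_eq_same]
    rw [if_pos (show ∀ l : d, l ≠ j → (Pi.single j m : d → ℤ) l = 0 from
      fun l hl => Pi.single_eq_of_ne (M := fun _ : d => ℤ) hl m)]
  have hZ : HasSum (fun m : ℤ => c * (1 / (m : ℝ) ^ 2)) (c * (Real.pi ^ 2 / 3)) := hasSum_one_div_int_sq.mul_left c
  have hsupp' : ∀ x, x ∉ Set.range (fun m : ℤ => (Pi.single j m : d → ℤ)) → g x = 0 := fun x hx =>
    Function.notMem_support.mp fun h => hx (hsupp h)
  have hgs : Summable g := (hinj.summable_iff hsupp').mp (by rw [hcomp]; exact hZ.summable)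
  have hgsum : ∑' q, g q = c * (Real.pi ^ 2 / 3) := by
    rw [← hinj.tsum_eq hsupp, show (fun m : ℤ => g (Pi.single j m)) = g ∘ fun m : ℤ => (Pi.single j m : d → ℤ) from rfl,
      hcomp, hZ.tsum_eq]
  have hnn : ∀ q : d → ℤ, 0 ≤ (|(q j : ℝ)|) ^ r * ‖mFourierCoeff (Θ 0) q‖ := fun q => by positivity
  have hs : Summable fun q : d → ℤ => (|(q j : ℝ)|) ^ r * ‖mFourierCoeff (Θ 0) q‖ := hgs.of_nonneg_of_le hnn hpt
  refine ⟨hs, (hs.tsum_le_tsum hpt hgs).trans ?_⟩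
  rw [hgsum, hc]
  -- `B/(2π)^{r+2} · π²/3 = B/(12 (2π)^r)`
  rw [pow_add]
  field_simp
  ring_nf
  exact le_rfl

end Summit.AnomalousDissipation.AnomalousDissipation.Theorems.SawtoothPulseCascade.K1Slot
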